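import Literature.AnabelianGeometry.EtaleTheta.ClassicalTheta
import Summits.ABC.IUTFork.Repair.RHAxisCK1Requirements

/-!
# R4-3 falsifier faces for card `biext-neron-slice` (rh4-crit-1 instrument; scratch level, cell currency / classical theta only)

`F_ref(Ü) := Θ̈(Ü·Ü_ref)/(Θ̈(Ü)·Θ̈(Ü_ref))` (the card's biextension slice; same body as rh4-id-3's scratch `biextSlice`).
Faces used in `ROUND4/IDEAS/crit-biext-neron-slice-rh4-crit-1.md`:
* GAUGE: `biextSlice_periodLift` — replacing the lift `Ü_ref` of the SAME point `ref ∈ E = 𝔾_m/q^ℤ` by `q̈·Ü_ref` multiplies the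
  slice by `Ü^{-2}`: the slope of the «linear label law» is defined only modulo 2 (units `ord q̈` per label).
* INVOLUTION: `biextSlice_inv` — the elliptic involution `Ü ↦ Ü⁻¹` carries the slice at `Ü_ref` to MINUS the slice at `Ü_ref⁻¹`
  (slope `-c`): a `±`-symmetric datum carries both slopes; `biextSlice_inv_arg_of_sq` — for an exact 2-torsion lift
  (`Ü_ref² = q̈`) the involution at the SAME lift gives `F_ref(Ü⁻¹) = −Ü²·F_ref(Ü)` (ι-odd, not fixed up to a
  constant — contrast [EtTh] Prop 1.5 (iii) for `η̈^Θ`).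
* PARITY: `slope_zero_of_affInv` (over ℤ), `slope_zero_of_affInv_zmod_odd` (over `ZMod n`, every odd `n`; tight:
  `affInv_slope_one_zmod2`) and `slope_zero_of_affInv_zmod13/7/5` (by `decide`) — a law
  `a ↦ s·a + d` invariant under an affine involution `a ↦ c − a` has `s = 0`; `halfShift_moves_sliceLaw` — the card's
  involution `a ↦ −1−a` does NOT fix the slice law `a ↦ a`.
* O-33 ROUND 2 (rh4-id-3 `R4Round2Scratch` 7732393ec4538f88): `orientedOddSum_zero` (an odd law nets to zero over oriented labels `−n … n`),
  `orientedSum_l13`, `tentSum_l13` (the even tent law does not: 42), `halfOriented_l13` (15 vs print's 85).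
Nothing here is an IUT object or a Literature fact. [folklore]
-/

noncomputable section
namespace Summit.ABC.IUTFork.Repair.RH.BiextSliceFaces
open Literature.AnabelianGeometry.EtaleTheta

variable {𝕜 : Type*} [NormedField 𝕜]

/-- The biextension-slice section (rh4-id-3 scratch, same body). [folklore] -/
def biextSlice (q2 Uref U : 𝕜) : 𝕜 :=
  thetaDdot q2 (U * Uref) / (thetaDdot q2 U * thetaDdot q2 Uref)

/-- GAUGE FACE: another lift of the same reference point (`Ü_ref ↦ q̈·Ü_ref`) twists the slice by `Ü⁻²`. [folklore] -/
theorem biextSlice_periodLift {q2 Uref U : 𝕜} (hq : q2 ≠ 0) (hr : Uref ≠ 0) (hU : U ≠ 0) :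
    biextSlice q2 (q2 * Uref) U = U ^ (-(2 : ℤ)) * biextSlice q2 Uref U := by
  unfold biextSlice
  have h1 := thetaDdot_zpow_mul hq (mul_ne_zero hU hr) 1
  have h2 := thetaDdot_zpow_mul hq hr 1
  simp only [zpow_one] at h1 h2
  rw [show U * (q2 * Uref) = q2 * (U * Uref) by ring, h1, h2, mul_zpow]
  have hc : (((1 : ℤ).negOnePow : ℤ) : 𝕜) * q2 ^ (-(1 * 1 : ℤ)) * Uref ^ (-(2 * 1 : ℤ)) ≠ 0 := by
    refine mul_ne_zero (mul_ne_zero ?_ (zpow_ne_zero _ hq)) (zpow_ne_zero _ hr)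
    rw [Int.cast_negOnePow]; exact zpow_ne_zero _ (neg_ne_zero.mpr one_ne_zero)
  set c := (((1 : ℤ).negOnePow : ℤ) : 𝕜) * q2 ^ (-(1 * 1 : ℤ)) * Uref ^ (-(2 * 1 : ℤ)) with hcdef
  rw [show (((1 : ℤ).negOnePow : ℤ) : 𝕜) * q2 ^ (-(1 * 1 : ℤ)) * (U ^ (-(2 * 1 : ℤ)) * Uref ^ (-(2 * 1 : ℤ))) *
        thetaDdot q2 (U * Uref) = c * (U ^ (-(2 : ℤ)) * thetaDdot q2 (U * Uref)) by
        simp only [hcdef, mul_one]; ring,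
      show thetaDdot q2 U * (c * thetaDdot q2 Uref) = c * (thetaDdot q2 U * thetaDdot q2 Uref) by ring,
      mul_div_mul_left _ _ hc, mul_div_assoc]

/-- INVOLUTION FACE: `F_{ref⁻¹}(Ü⁻¹) = −F_ref(Ü)` (from `Θ̈(Ü⁻¹) = −Θ̈(Ü)`, PROVED in the tree). [folklore] -/
theorem biextSlice_inv (q2 Uref U : 𝕜) :
    biextSlice q2 Uref⁻¹ U⁻¹ = -biextSlice q2 Uref U := by
  unfold biextSlice
  rw [show U⁻¹ * Uref⁻¹ = (U * Uref)⁻¹ by rw [mul_inv], thetaDdot_inv, thetaDdot_inv, thetaDdot_inv,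
    neg_mul_neg, neg_div]

/-- PARITY FACE (ℤ-lifted labels): an affine label law invariant under an affine involution `a ↦ c − a` is constant. [folklore] -/
theorem slope_zero_of_affInv (s d c : ℤ) (h : ∀ a : ℤ, s * (c - a) + d = s * a + d) : s = 0 := by
  have h0 := h 0
  have h1 := h (c + 1)
  nlinarith [h0, h1]

/-- The card's involution `a ↦ −1 − a` (fixed label `l⋆`) moves the slice law `a ↦ a` (already at `a = 0`). [folklore] -/
theorem halfShift_moves_sliceLaw : ¬ ∀ a : ℤ, (-1 - a : ℤ) = a := fun h => by
  have := h 0; omega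

/-- PARITY FACE over `F_13`: any law `a ↦ s·a` on `ZMod 13` invariant under some involution `a ↦ c − a` has `s = 0`. [folklore] -/
theorem slope_zero_of_affInv_zmod13 : ∀ s c : ZMod 13, (∀ a : ZMod 13, s * (c - a) = s * a) → s = 0 := by
  decide

/-- Same over `F_7`. [folklore] -/
theorem slope_zero_of_affInv_zmod7 : ∀ s c : ZMod 7, (∀ a : ZMod 7, s * (c - a) = s * a) → s = 0 := by
  decide

/-- Same over `F_5`. [folklore] -/
theorem slope_zero_of_affInv_zmod5 : ∀ s c : ZMod 5, (∀ a : ZMod 5, s * (c - a) = s * a) → s = 0 := by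
  decide

/-- ι-ODDNESS FACE (exact 2-torsion lift `Ü_ref² = q̈`): the elliptic involution `Ü ↦ Ü⁻¹` at the SAME
reference lift multiplies the slice by `−Ü²` — it is NOT fixed up to a constant (contrast `thetaDdot_inv`:
`Θ̈(Ü⁻¹) = −Θ̈(Ü)`, fixed up to sign; print: [EtTh] Prop 1.5 (iii) — ι fixes `η̈^Θ + log O^×` and negates
`log(Ü) + log O^×`). Consequence: at the label points `q̈^a·ζ` and `q̈^{−a}·ζ⁻¹` the orders differ by
`2a·ord(q̈)`, i.e. the law is odd. [folklore] -/
theorem biextSlice_inv_arg_of_sq {q2 Uref U : 𝕜} (hq : q2 ≠ 0) (hr : Uref ≠ 0) (hU : U ≠ 0)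
    (hsq : Uref * Uref = q2) :
    biextSlice q2 Uref U⁻¹ = -U ^ (2 : ℤ) * biextSlice q2 Uref U := by
  have hlift : q2 * Uref⁻¹ = Uref := by rw [← hsq, mul_assoc, mul_inv_cancel₀ hr, mul_one]
  have h := biextSlice_periodLift hq (inv_ne_zero hr) (inv_ne_zero hU) (q2 := q2)
  rw [hlift, biextSlice_inv, inv_zpow', neg_neg] at h
  rw [h]; ring

/-- Norm form of `biextSlice_inv_arg_of_sq`: `‖F_ref(Ü⁻¹)‖ = ‖Ü‖² · ‖F_ref(Ü)‖`. [folklore] -/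
theorem norm_biextSlice_inv_arg_of_sq {q2 Uref U : 𝕜} (hq : q2 ≠ 0) (hr : Uref ≠ 0) (hU : U ≠ 0)
    (hsq : Uref * Uref = q2) :
    ‖biextSlice q2 Uref U⁻¹‖ = ‖U‖ ^ (2 : ℤ) * ‖biextSlice q2 Uref U‖ := by
  rw [biextSlice_inv_arg_of_sq hq hr hU hsq, norm_mul, norm_neg, norm_zpow]

/-- PARITY FACE over `ZMod n` for every ODD `n` (all print's `l` are odd primes): any law `a ↦ s·a + d` invariant
under some affine involution `a ↦ c − a` has `s = 0`. [folklore] -/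
theorem slope_zero_of_affInv_zmod_odd {n : ℕ} (hn : Odd n) (s d c : ZMod n)
    (h : ∀ a : ZMod n, s * (c - a) + d = s * a + d) : s = 0 := by
  have h0 : s * c = 0 := by simpa using h 0
  have h1 : s * (c - (c + 1)) + d = s * (c + 1) + d := h (c + 1)
  have h2 : (2 : ZMod n) * s = 0 := by
    have : -s = s * c + s := by
      have := add_right_cancel h1
      simpa [mul_add, sub_eq_add_neg] using this
    rw [h0, zero_add] at this
    linear_combination -this
  have hu : IsUnit (2 : ZMod n) := by
    have hcop : Nat.Coprime 2 n := Nat.coprime_two_left.mpr hn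
    simpa using (ZMod.unitOfCoprime 2 hcop).isUnit
  exact (hu.mul_right_eq_zero).mp h2

/-- Without oddness the face fails: over `ZMod 2` the law `a ↦ a` IS invariant under `a ↦ 0 − a` (so `l` odd is used). [folklore] -/
theorem affInv_slope_one_zmod2 : ∀ a : ZMod 2, (1 : ZMod 2) * (0 - a) + 0 = 1 * a + 0 := by
  decide

/-! ## O-33 round 2 (rh4-id-3 g1 scratch `R4Round2Scratch.lean` 7732393ec4538f88, bytes re-homed here by the typer rh4-typ-1 at
rh-ref-1's R4REF-1B flag 15:06Z): the FULL-ORIENTED packaging of an odd law nets to zero -/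

section Round2
open Finset

/-- Oriented labels `t ∈ {−n, …, n}` (V4B «J^±», no `±` quotient): an ODD value law `t ↦ c·t` has label-sum ZERO, so the
full-oriented packaging of the biext slice carries no net demand (id-3 round 2; crit-1 ADDENDUM A2 «full orientation
KILLED-BY-CONSISTENCY»). [folklore] -/
theorem orientedOddSum_zero (n : ℕ) (c : ℤ) :
    ∑ t ∈ Icc (-(n : ℤ)) n, c * t = 0 := by
  have h : ∑ t ∈ Icc (-(n : ℤ)) n, c * t = ∑ t ∈ Icc (-(n : ℤ)) n, c * (-t) := by
    apply Finset.sum_nbij' (fun t => -t) (fun t => -t)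
    · intro a ha; simp only [mem_Icc] at ha ⊢; omega
    · intro a ha; simp only [mem_Icc] at ha ⊢; omega
    · intro a _; simp
    · intro a _; simp
    · intro a _; simp
  have h2 : ∑ t ∈ Icc (-(n : ℤ)) n, c * (-t) = -(∑ t ∈ Icc (-(n : ℤ)) n, c * t) := by
    rw [← Finset.sum_neg_distrib]; congr 1; ext t; ring
  linarith

/-- The same at print's `l = 13` (labels `±1 … ±6`, zero label harmless): `∑_{t=−6}^{6} t = 0`. [folklore] -/
theorem orientedSum_l13 : ∑ t ∈ Icc (-6 : ℤ) 6, t = 0 := by decide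

/-- The EVEN tent law `t ↦ |t|` (the `l`-isogenous theta of card `isogenous-theta-first-power`, `IsoThetaFaces.norm_isoTheta_abs`) does NOT
net to zero: `l = 13`: `∑_{t=−6}^{6} |t| = 42 = 2·(1+…+6)`. [folklore] -/
theorem tentSum_l13 : ∑ t ∈ Icc (-6 : ℤ) 6, |t| = 42 := by decide

/-- Half-orientation is a CHOICE: on the positive half the odd law is the κ′ = 1 door law `j ↦ j` with demand mass `∑_{j=1}^{6}(j − 1) = 15`
at `l = 13`, against print's `∑ (j² − 1) = 85`. [folklore] -/
theorem halfOriented_l13 : (∑ j ∈ Icc (1 : ℤ) 6, (j - 1) = 15) ∧ (∑ j ∈ Icc (1 : ℤ) 6, (j ^ 2 - 1) = 85) := by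
  constructor <;> decide

end Round2

end Summit.ABC.IUTFork.Repair.RH.BiextSliceFaces
end
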